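import Mathlib
import HarnessLib
import Literature.Geometry.DiscreteGeometry.SphericalCodeHullEuler
import Literature.Geometry.DiscreteGeometry.KissingNodeTypes

/-!
# Shell-hole cover I — azimuth gaps on a facet circle

Trigonometric core of the proof of `OverbindingBudgetGapFreeShellHole.ShellHoleBound (21/32)`
(files `OverbindingBudgetShellHoleGaps` → `…ShellHoleFacets` → `…ShellHoleCover`).

In the frame of a facet normal `c` of the twelve-point hull (level `κ = ‖c‖⁻¹` on the unit
sphere, signed azimuth `σ`), two tight vertices satisfy
`⟪w, w'⟫ = (1 − κ²) cos (σ w − σ w') + κ²` (`inner_eq_of_levels_signed`).  With the separation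
`⟪w, w'⟫ ≤ cₐ = 1 − 1/(2·1.01²)` every azimuth gap lies in `(π/4, 7π/4)` (`gap_window`); if
`κ² < c_b = 1 − 1.01²/2` a bonded pair (`⟪w, w'⟫ ≥ c_b`) has a gap `< π/2` (`bond_gap`), so a
facet all of whose edges are bonds cannot close up (`three_gaps_false`, `four_gaps_false`), and
a triangle with two bond edges at the apex `v` and a fourth point `z` (level `α ≤ κ`) bonded
to both base vertices forces `⟪z, v⟫ > cₐ` (`bbd_core`, `no_bbd`).
-/

namespace Summit.AtomisticToContinuum.Crystallization.Theorems.OverbindingBudgetShellHoleGaps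

open Real RealInnerProductSpace Literature.Geometry.DiscreteGeometry

/-! ## Real and trigonometric lemmas -/

/-- `0.7 < cos (π/4)`. -/
theorem seven_tenths_lt_cos_pi_div_four : (0.7 : ℝ) < cos (π / 4) := by
  rw [Real.cos_pi_div_four]
  have h : (1.4 : ℝ) < Real.sqrt 2 := by
    rw [show (1.4 : ℝ) = Real.sqrt (1.4 ^ 2) by rw [Real.sqrt_sq (by norm_num)]]
    exact Real.sqrt_lt_sqrt (by norm_num) (by norm_num)
  linarith

/-- **Separation window for an azimuth gap.**  If two points of the facet circle
(`⟪y, y'⟫ = ρ² cos g + κ²`, `ρ² = 1 − κ²`) are separated (`⟪y, y'⟫ ≤ 0.50985`) then their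
azimuth gap `g ∈ (0, 2π)` lies in `(π/4, 7π/4)`. -/
theorem gap_window {κ ρ g : ℝ} (hρ : ρ ^ 2 = 1 - κ ^ 2) (hg0 : 0 < g) (hg2 : g < 2 * π)
    (hsep : ρ ^ 2 * cos g + κ ^ 2 ≤ 1 - 1 / (2 * (101 / 100 : ℝ) ^ 2)) :
    π / 4 < g ∧ g < 7 * π / 4 := by
  have hcos : cos g < 0.7 := by
    by_contra h
    push Not at h
    have : ρ ^ 2 * 0.7 ≤ ρ ^ 2 * cos g := mul_le_mul_of_nonneg_left h (by positivity)
    rw [hρ] at this hsep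
    norm_num at hsep this
    nlinarith [sq_nonneg κ]
  have h7 := seven_tenths_lt_cos_pi_div_four
  constructor
  · by_contra hle
    push Not at hle
    have := Real.cos_le_cos_of_nonneg_of_le_pi hg0.le (by linarith [Real.pi_pos]) hle
    linarith
  · by_contra hle
    push Not at hle
    have h1 : cos (2 * π - g) = cos g := Real.cos_two_pi_sub g
    have h2 := Real.cos_le_cos_of_nonneg_of_le_pi (x := 2 * π - g) (y := π / 4)
      (by linarith) (by linarith [Real.pi_pos]) (by linarith)
    linarith

/-- **A bond gap is short**: if moreover `⟪y, y'⟫ ≥ cb = 1 − 1.01²/2` and `κ² < cb`, then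
`cos g > 0`, so `g < π/2` or `g > 3π/2`. -/
theorem bond_gap {κ ρ g : ℝ}
    (hκ : κ ^ 2 < 1 - (101 / 100 : ℝ) ^ 2 / 2)
    (hbond : 1 - (101 / 100 : ℝ) ^ 2 / 2 ≤ ρ ^ 2 * cos g + κ ^ 2) :
    g < π / 2 ∨ 3 * π / 2 < g := by
  have hpos : 0 < cos g := by
    by_contra h
    push Not at h
    have : ρ ^ 2 * cos g ≤ 0 := mul_nonpos_of_nonneg_of_nonpos (by positivity) h
    linarith
  by_contra h
  push Not at h
  have := Real.cos_nonpos_of_pi_div_two_le_of_le h.1 (by linarith)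
  linarith

/-- `cos P ≥ 0.95` from `cos (P + a) > 0`, `cos (P - b) > 0` with `a, b ∈ (0, π/2)`,
`cos a, cos b ≤ 0.31`. -/
theorem cos_ge_of_between {P a b : ℝ} (ha0 : 0 < a) (ha : a < π / 2) (hb0 : 0 < b)
    (hb : b < π / 2) (hca : cos a ≤ 0.31) (hcb : cos b ≤ 0.31) (h1 : 0 < cos (P + a))
    (h2 : 0 < cos (P - b)) : 0.95 ≤ cos P := by
  have hcapos : 0 < cos a := Real.cos_pos_of_mem_Ioo ⟨by linarith, ha⟩
  have hcbpos : 0 < cos b := Real.cos_pos_of_mem_Ioo ⟨by linarith, hb⟩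
  have hsapos : 0 < sin a := Real.sin_pos_of_pos_of_lt_pi ha0 (by linarith)
  have hsbpos : 0 < sin b := Real.sin_pos_of_pos_of_lt_pi hb0 (by linarith)
  have hPa := Real.cos_sq_add_sin_sq P
  have haa := Real.cos_sq_add_sin_sq a
  have hbb := Real.cos_sq_add_sin_sq b
  have hsa2 : 0.9039 ≤ sin a ^ 2 := by nlinarith
  have hsb2 : 0.9039 ≤ sin b ^ 2 := by nlinarith
  rcases le_total 0 (sin P) with hsP | hsP
  · rw [Real.cos_add] at h1
    -- cos P cos a > sin P sin a ≥ 0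
    have hcP : 0 < cos P := by
      by_contra h; push Not at h
      have : cos P * cos a ≤ 0 := mul_nonpos_of_nonpos_of_nonneg h hcapos.le
      nlinarith [mul_nonneg hsP hsapos.le]
    have hge : sin P * sin a ≤ cos P * cos a := by linarith
    have hsq : (sin P * sin a) ^ 2 ≤ (cos P * cos a) ^ 2 :=
      pow_le_pow_left₀ (mul_nonneg hsP hsapos.le) hge 2
    have hc2 : sin a ^ 2 ≤ cos P ^ 2 := by nlinarith
    nlinarith
  · rw [Real.cos_sub] at h2
    have hcP : 0 < cos P := by
      by_contra h; push Not at h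
      have : cos P * cos b ≤ 0 := mul_nonpos_of_nonpos_of_nonneg h hcbpos.le
      nlinarith [mul_nonpos_of_nonpos_of_nonneg hsP hsbpos.le]
    have hge : -sin P * sin b ≤ cos P * cos b := by nlinarith
    have hsq : (-sin P * sin b) ^ 2 ≤ (cos P * cos b) ^ 2 :=
      pow_le_pow_left₀ (by nlinarith) hge 2
    have hc2 : sin b ^ 2 ≤ cos P ^ 2 := by nlinarith
    nlinarith

/-- **The BBD core inequality.**  Circle of a facet at level `κ` (`ρ² = 1 − κ²`,
`0.2938 ≤ κ² < cb`), a fourth unit point at level `α ≤ κ` (`β² = 1 − α²`) bonded to the two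
ends `u, w` of a bond path `u ∼ v ∼ w` on the circle with azimuth gaps `a, b < π/2`: then the
fourth point is within the separation angle of the apex `v`. -/
theorem bbd_core {κ ρ α β a b P : ℝ} (hκ0 : 0 < κ) (hκlo : 0.2938 ≤ κ ^ 2)
    (hκcb : κ ^ 2 < 1 - (101 / 100 : ℝ) ^ 2 / 2) (hρ : ρ ^ 2 = 1 - κ ^ 2) (hρ0 : 0 ≤ ρ)
    (hβ : β ^ 2 = 1 - α ^ 2) (hβ0 : 0 ≤ β) (hα : α ≤ κ)
    (ha0 : 0 < a) (ha : a < π / 2) (hb0 : 0 < b) (hb : b < π / 2)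
    (hsa : ρ ^ 2 * cos a + κ ^ 2 ≤ 1 - 1 / (2 * (101 / 100 : ℝ) ^ 2))
    (hsb : ρ ^ 2 * cos b + κ ^ 2 ≤ 1 - 1 / (2 * (101 / 100 : ℝ) ^ 2))
    (h1 : 1 - (101 / 100 : ℝ) ^ 2 / 2 ≤ β * ρ * cos (P + a) + α * κ)
    (h2 : 1 - (101 / 100 : ℝ) ^ 2 / 2 ≤ β * ρ * cos (P - b) + α * κ) :
    1 - 1 / (2 * (101 / 100 : ℝ) ^ 2) < β * ρ * cos P + α * κ := by
  norm_num at hκcb hsa hsb h1 h2 ⊢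
  have hcapos : 0 < cos a := Real.cos_pos_of_mem_Ioo ⟨by linarith, ha⟩
  have hcbpos : 0 < cos b := Real.cos_pos_of_mem_Ioo ⟨by linarith, hb⟩
  have hsapos : 0 < sin a := Real.sin_pos_of_pos_of_lt_pi ha0 (by linarith)
  have hsbpos : 0 < sin b := Real.sin_pos_of_pos_of_lt_pi hb0 (by linarith)
  -- cos a, cos b ≤ 0.31
  have h1κ : 0 < 1 - κ ^ 2 := by linarith
  have hca : cos a ≤ 0.31 := by
    by_contra h; push Not at h
    have : (1 - κ ^ 2) * 0.31 < (1 - κ ^ 2) * cos a := mul_lt_mul_of_pos_left h h1κ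
    rw [hρ] at hsa; linarith
  have hcb : cos b ≤ 0.31 := by
    by_contra h; push Not at h
    have : (1 - κ ^ 2) * 0.31 < (1 - κ ^ 2) * cos b := mul_lt_mul_of_pos_left h h1κ
    rw [hρ] at hsb; linarith
  -- T := cb − ακ > 0
  have hακ : α * κ ≤ κ ^ 2 := by
    rw [sq]; exact mul_le_mul_of_nonneg_right hα hκ0.le
  have hT : 0 < 9799 / 20000 - α * κ := by linarith
  have hβρ : 0 ≤ β * ρ := mul_nonneg hβ0 hρ0
  have h1' : 9799 / 20000 - α * κ ≤ β * ρ * cos (P + a) := by linarith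
  have h2' : 9799 / 20000 - α * κ ≤ β * ρ * cos (P - b) := by linarith
  have hc1 : 0 < cos (P + a) := by
    by_contra h; push Not at h
    have := mul_nonpos_of_nonneg_of_nonpos hβρ h
    linarith
  have hc2 : 0 < cos (P - b) := by
    by_contra h; push Not at h
    have := mul_nonpos_of_nonneg_of_nonpos hβρ h
    linarith
  have hcosP : 0.95 ≤ cos P := cos_ge_of_between ha0 ha hb0 hb hca hcb hc1 hc2
  -- the identity sin b · cos (P + a) + sin a · cos (P − b) = cos P · sin (a + b)
  have hid : sin b * cos (P + a) + sin a * cos (P - b) = cos P * sin (a + b) := by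
    rw [Real.cos_add, Real.cos_sub, Real.sin_add]; ring
  have hI : (9799 / 20000 - α * κ) * (sin a + sin b) ≤ β * ρ * cos P * sin (a + b) := by
    have e1 := mul_le_mul_of_nonneg_left h1' hsbpos.le
    have e2 := mul_le_mul_of_nonneg_left h2' hsapos.le
    have : sin b * (β * ρ * cos (P + a)) + sin a * (β * ρ * cos (P - b)) =
        β * ρ * cos P * sin (a + b) := by
      linear_combination (β * ρ) * hid
    linarith
  have hsab : sin (a + b) ≤ 0.31 * (sin a + sin b) := by
    rw [Real.sin_add]
    have e1 := mul_le_mul_of_nonneg_left hcb hsapos.le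
    have e2 := mul_le_mul_of_nonneg_right hca hsbpos.le
    linarith
  have hβρP : 0 ≤ β * ρ * cos P := mul_nonneg hβρ (by linarith)
  have hs : 0 < sin a + sin b := by linarith
  have hkey : 9799 / 20000 - α * κ ≤ 0.31 * (β * ρ * cos P) := by
    have h3 : β * ρ * cos P * sin (a + b) ≤ β * ρ * cos P * (0.31 * (sin a + sin b)) :=
      mul_le_mul_of_nonneg_left hsab hβρP
    by_contra h; push Not at h
    have h4 := mul_lt_mul_of_pos_right h hs
    linarith
  rcases le_or_gt (α * κ) (9799 / 40000) with hA | hB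
  · -- case ακ ≤ cb/2
    linarith
  · -- case ακ > cb/2 : α > 0, β ≥ ρ
    have hαpos : 0 < α := by
      by_contra h; push Not at h
      have := mul_nonpos_of_nonpos_of_nonneg h hκ0.le
      linarith
    have hα2 : α ^ 2 ≤ κ ^ 2 := pow_le_pow_left₀ hαpos.le hα 2
    have hβρ2 : ρ ^ 2 ≤ β ^ 2 := by rw [hβ, hρ]; linarith
    have hρβ : ρ ≤ β := (pow_le_pow_iff_left₀ hρ0 hβ0 (by norm_num)).1 hβρ2
    have hprod : 1 - κ ^ 2 ≤ β * ρ := by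
      rw [← hρ, sq]; exact mul_le_mul_of_nonneg_right hρβ hρ0
    have hX : (1 - κ ^ 2) * 0.95 ≤ β * ρ * cos P := mul_le_mul hprod hcosP (by norm_num) hβρ
    nlinarith


/-- Three gaps in `(π/4, 7π/4)` summing to `2π` cannot all be bond gaps. -/
theorem three_gaps_false {g0 g1 g2 : ℝ} (hsum : g0 + g1 + g2 = 2 * π) (h0 : π / 4 < g0)
    (h1 : π / 4 < g1) (h2 : π / 4 < g2) (b0 : g0 < π / 2 ∨ 3 * π / 2 < g0)
    (b1 : g1 < π / 2 ∨ 3 * π / 2 < g1) (b2 : g2 < π / 2 ∨ 3 * π / 2 < g2) : False := by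
  have hπ := Real.pi_pos
  rcases b0 with b0 | b0 <;> rcases b1 with b1 | b1 <;> rcases b2 with b2 | b2 <;> linarith

/-- Four gaps in `(π/4, 7π/4)` summing to `2π` cannot all be bond gaps. -/
theorem four_gaps_false {g0 g1 g2 g3 : ℝ} (hsum : g0 + g1 + g2 + g3 = 2 * π)
    (h0 : π / 4 < g0) (h1 : π / 4 < g1) (h2 : π / 4 < g2) (h3 : π / 4 < g3)
    (b0 : g0 < π / 2 ∨ 3 * π / 2 < g0) (b1 : g1 < π / 2 ∨ 3 * π / 2 < g1)
    (b2 : g2 < π / 2 ∨ 3 * π / 2 < g2) (b3 : g3 < π / 2 ∨ 3 * π / 2 < g3) : False := by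
  have hπ := Real.pi_pos
  rcases b0 with b0 | b0 <;> rcases b1 with b1 | b1 <;> rcases b2 with b2 | b2 <;>
    rcases b3 with b3 | b3 <;> linarith

/-- Two bond gaps out of three gaps in `(π/4, 7π/4)` summing to `2π` are both `< π/2`. -/
theorem two_bond_gaps {a b g : ℝ} (hsum : a + b + g = 2 * π) (ha : π / 4 < a)
    (hb : π / 4 < b) (hg : π / 4 < g) (ba : a < π / 2 ∨ 3 * π / 2 < a)
    (bb : b < π / 2 ∨ 3 * π / 2 < b) : a < π / 2 ∧ b < π / 2 := by
  have hπ := Real.pi_pos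
  rcases ba with ba | ba <;> rcases bb with bb | bb
  · exact ⟨ba, bb⟩
  all_goals exfalso; linarith

/-! ## The facet frame: inner products from levels and azimuths -/

/-- **Inner product of two unit vectors at levels `α`, `κ` about a unit axis `v`** in terms of
their azimuths: `⟪u, u'⟫ = √(1−α²) √(1−κ²) cos (θ − θ') + α κ`. -/
theorem inner_eq_of_levels {v u u' : EuclideanSpace ℝ (Fin 3)} (hv : ‖v‖ = 1) (hu : ‖u‖ = 1) (hu' : ‖u'‖ = 1)
    {α κ : ℝ} (hvu : ⟪v, u⟫ = α) (hvu' : ⟪v, u'⟫ = κ) :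
    ⟪u, u'⟫ = Real.sqrt (1 - α ^ 2) * Real.sqrt (1 - κ ^ 2) *
        Real.cos (azimuth v hv u - azimuth v hv u') + α * κ := by
  obtain ⟨h0, h1⟩ := inner_frame_eq_polar (hv := hv) hu hvu
  obtain ⟨h0', h1'⟩ := inner_frame_eq_polar (hv := hv) hu' hvu'
  rw [inner_eq_sum_three (tangentFrame v hv), tangentFrame_two v hv, hvu, hvu', h0, h1, h0',
    h1', Real.cos_sub]
  ring

/-- The same in terms of **signed** azimuths about the facet axis of `c ≠ 0`. -/
theorem inner_eq_of_levels_signed {c : EuclideanSpace ℝ (Fin 3)} (hc : c ≠ 0) {u u' : EuclideanSpace ℝ (Fin 3)} (hu : ‖u‖ = 1)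
    (hu' : ‖u'‖ = 1) {α κ : ℝ} (hvu : ⟪facetAxis c, u⟫ = α) (hvu' : ⟪facetAxis c, u'⟫ = κ) :
    ⟪u, u'⟫ = Real.sqrt (1 - α ^ 2) * Real.sqrt (1 - κ ^ 2) *
        Real.cos (signedAzimuth c hc u - signedAzimuth c hc u') + α * κ := by
  rw [inner_eq_of_levels (norm_facetAxis hc) hu hu' hvu hvu']
  unfold signedAzimuth
  rcases facetSign_eq_or c hc with h | h
  · rw [h, one_mul, one_mul]
  · have key : ∀ θ θ' : ℝ, Real.cos (-1 * θ - -1 * θ') = Real.cos (θ - θ') := fun θ θ' => by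
      rw [neg_one_mul, neg_one_mul, neg_sub_neg, cos_sub_rev]
    rw [h, key]

/-- `{a, b} ≠ {c, d}` when `c ∉ {a, b}`. -/
theorem pair_ne_of_ne {a b c d : EuclideanSpace ℝ (Fin 3)} (h1 : c ≠ a) (h2 : c ≠ b) :
    ({a, b} : Finset (EuclideanSpace ℝ (Fin 3))) ≠ {c, d} := by
  intro h
  have : c ∈ ({a, b} : Finset (EuclideanSpace ℝ (Fin 3))) := by rw [h]; exact Finset.mem_insert_self _ _
  rw [Finset.mem_insert, Finset.mem_singleton] at this
  rcases this with h | h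
  · exact h1 h
  · exact h2 h

/-- `{a, b} ≠ {c, d}` when `a ∉ {c, d}`. -/
theorem pair_ne_of_ne_left {a b c d : EuclideanSpace ℝ (Fin 3)} (h1 : a ≠ c) (h2 : a ≠ d) :
    ({a, b} : Finset (EuclideanSpace ℝ (Fin 3))) ≠ {c, d} := fun h => pair_ne_of_ne h1 h2 h.symm

/-- **No BBD facet is too large.**  Unit vectors `u, v, w` tight for `c` (on the facet circle
at level `κ = ‖c‖⁻¹`, `0.2938 ≤ κ² < c_b`) with bond azimuth gaps `a` (from `u` to `v`) and
`b` (from `v` to `w`) in `(0, π/2)`, separated (`⟪u, v⟫, ⟪w, v⟫ ≤ cₐ`), and a fourth unit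
vector `z` below the facet plane (`⟪c, z⟫ ≤ 1`) bonded to `u` and `w`: then `⟪z, v⟫ > cₐ`. -/
theorem no_bbd {c u v w z : EuclideanSpace ℝ (Fin 3)} (hc0 : c ≠ 0) (hκlo : 0.2938 ≤ ‖c‖⁻¹ ^ 2)
    (hlt : ‖c‖⁻¹ ^ 2 < 1 - (101 / 100 : ℝ) ^ 2 / 2)
    (hu1 : ‖u‖ = 1) (hv1 : ‖v‖ = 1) (hw1 : ‖w‖ = 1) (hz1 : ‖z‖ = 1)
    (hcu : ⟪c, u⟫ = 1) (hcv : ⟪c, v⟫ = 1) (hcw : ⟪c, w⟫ = 1) (hcz : ⟪c, z⟫ ≤ 1)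
    {a b : ℝ} (ha0 : 0 < a) (ha : a < π / 2) (hb0 : 0 < b) (hb : b < π / 2)
    (hka : a = signedAzimuth c hc0 v - signedAzimuth c hc0 u ∨
      a = signedAzimuth c hc0 v - signedAzimuth c hc0 u + 2 * π)
    (hkb : b = signedAzimuth c hc0 w - signedAzimuth c hc0 v ∨
      b = signedAzimuth c hc0 w - signedAzimuth c hc0 v + 2 * π)
    (hsuv : ⟪u, v⟫ ≤ 1 - 1 / (2 * (101 / 100 : ℝ) ^ 2))
    (hswv : ⟪w, v⟫ ≤ 1 - 1 / (2 * (101 / 100 : ℝ) ^ 2))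
    (hbu : 1 - (101 / 100 : ℝ) ^ 2 / 2 ≤ ⟪z, u⟫) (hbw : 1 - (101 / 100 : ℝ) ^ 2 / 2 ≤ ⟪z, w⟫) :
    1 - 1 / (2 * (101 / 100 : ℝ) ^ 2) < ⟪z, v⟫ := by
  set κ := ‖c‖⁻¹ with hκ
  have hκnn : 0 ≤ κ := inv_nonneg.2 (norm_nonneg c)
  have hκ0 : 0 < κ := by
    rcases hκnn.eq_or_lt with h | h
    · rw [← h] at hκlo; norm_num at hκlo
    · exact h
  have hκ2 : κ ^ 2 ≤ 1 := by norm_num at hlt; linarith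
  set ρ := Real.sqrt (1 - κ ^ 2) with hρ
  have hρ2 : ρ ^ 2 = 1 - κ ^ 2 := Real.sq_sqrt (by linarith)
  have hρ0 : 0 ≤ ρ := Real.sqrt_nonneg _
  set α := ⟪facetAxis c, z⟫ with hα
  have hακ : α ≤ κ := by
    rw [hα, facetAxis, real_inner_smul_left]
    exact mul_le_of_le_one_right hκnn hcz
  have hα2 : α ^ 2 ≤ 1 := by
    have h := abs_real_inner_le_norm (facetAxis c) z
    rw [norm_facetAxis hc0, hz1, one_mul] at h
    have := abs_le.1 h
    nlinarith [this.1, this.2]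
  set β := Real.sqrt (1 - α ^ 2) with hβ
  have hβ2 : β ^ 2 = 1 - α ^ 2 := Real.sq_sqrt (by linarith)
  have hβ0 : 0 ≤ β := Real.sqrt_nonneg _
  have hlu : ⟪facetAxis c, u⟫ = κ := inner_facetAxis_of_tight hcu
  have hlv : ⟪facetAxis c, v⟫ = κ := inner_facetAxis_of_tight hcv
  have hlw : ⟪facetAxis c, w⟫ = κ := inner_facetAxis_of_tight hcw
  set P := signedAzimuth c hc0 z - signedAzimuth c hc0 v with hP
  have hρρ : Real.sqrt (1 - κ ^ 2) * Real.sqrt (1 - κ ^ 2) = ρ ^ 2 := by rw [hρ]; exact (sq _).symm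
  -- the five inner products in the frame
  have euv : ⟪u, v⟫ = ρ ^ 2 * Real.cos a + κ ^ 2 := by
    rw [inner_eq_of_levels_signed hc0 hu1 hv1 hlu hlv, hρρ, sq κ, cos_sub_rev]
    rcases hka with h | h
    · rw [h]
    · rw [h, Real.cos_add_two_pi]
  have ewv : ⟪w, v⟫ = ρ ^ 2 * Real.cos b + κ ^ 2 := by
    rw [inner_eq_of_levels_signed hc0 hw1 hv1 hlw hlv, hρρ, sq κ]
    rcases hkb with h | h
    · rw [h]
    · rw [h, Real.cos_add_two_pi]
  have ezv : ⟪z, v⟫ = β * ρ * Real.cos P + α * κ := by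
    rw [inner_eq_of_levels_signed hc0 hz1 hv1 rfl hlv]
  have ezu : ⟪z, u⟫ = β * ρ * Real.cos (P + a) + α * κ := by
    rw [inner_eq_of_levels_signed hc0 hz1 hu1 rfl hlu]
    rcases hka with h | h
    · rw [show signedAzimuth c hc0 z - signedAzimuth c hc0 u = P + a by rw [hP, h]; ring]
    · rw [show signedAzimuth c hc0 z - signedAzimuth c hc0 u = P + a - 2 * π by
        rw [hP, h]; ring, Real.cos_sub_two_pi]
  have ezw : ⟪z, w⟫ = β * ρ * Real.cos (P - b) + α * κ := by
    rw [inner_eq_of_levels_signed hc0 hz1 hw1 rfl hlw]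
    rcases hkb with h | h
    · rw [show signedAzimuth c hc0 z - signedAzimuth c hc0 w = P - b by rw [hP, h]; ring]
    · rw [show signedAzimuth c hc0 z - signedAzimuth c hc0 w = P - b + 2 * π by
        rw [hP, h]; ring, Real.cos_add_two_pi]
  rw [ezv]
  rw [euv] at hsuv
  rw [ewv] at hswv
  rw [ezu] at hbu
  rw [ezw] at hbw
  exact bbd_core hκ0 hκlo hlt hρ2 hρ0 hβ2 hβ0 hακ ha0 ha hb0 hb hsuv hswv hbu hbw


end Summit.AtomisticToContinuum.Crystallization.Theorems.OverbindingBudgetShellHoleGaps
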